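import Mathlib.MeasureTheory.Integral.Bochner.Basic
import Mathlib.MeasureTheory.Integral.Bochner.Set
import Mathlib.MeasureTheory.Integral.IntervalIntegral.Basic
import Mathlib.MeasureTheory.Function.LpSeminorm.CompareExp
import Mathlib.Analysis.SpecialFunctions.Pow.Continuity
import Mathlib.MeasureTheory.Measure.Lebesgue.Basic
import Mathlib.MeasureTheory.Measure.Haar.InnerProductSpace
import Mathlib.Topology.ContinuousMap.Bounded.Basic
import HarnessLib

/-!
# Hölder with exponents `3/2` and `3` against a constant (the `L³ₜL³ₓ` step of Lei–Zhang (2.4))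

Analysis/FluidPDE proofs file (theorems only), on the discharge path of the named fact
`Literature.Analysis.FluidPDE.LeiZhang2011_liouville` (Z. Lei, Q. S. Zhang, J. Funct. Anal. 261
(2011) = arXiv:1011.5066). In the passage from (2.3) to (2.4), p. 7 ("By Hölder inequality,
this implies …") the lower-order terms `∬ f²` and `∫ ‖f²‖_{L^{3/2}} ds` are bounded by
`‖f²‖_{L^{3/2}ₜₓ} = ‖f‖²_{L³ₜL³ₓ}` times powers of the measure of the cylinder. The elementary
inequality behind both is Hölder with exponents `3/2`, `3` against the constant function `1` on a
finite measure space: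

* `integral_le_measureReal_rpow_mul` — `∫ f ≤ μ(univ)^{1/3} (∫ f^{3/2})^{2/3}` for bounded
  a.e.-measurable `f ≥ 0`;
* `setIntegral_le_volumeReal_rpow_mul` — the same on a compact set of `ℝ³` for a continuous
  `f ≥ 0`;
* `intervalIntegral_rpow_two_thirds_le` — `∫_{t₁}^0 y^{2/3} ≤ (−t₁)^{1/3} (∫_{t₁}^0 y)^{2/3}`
  for `y ≥ 0` continuous on `[t₁, 0]`.

## References

* Z. Lei, Q. S. Zhang, J. Funct. Anal. 261 (2011) = arXiv:1011.5066, §2, p. 7, the Hölder step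
  "(2.3) implies (2.4)". [LeiZhang2011]
-/

noncomputable section

open MeasureTheory Set Function Filter Metric intervalIntegral
open scoped NNReal ENNReal

namespace Literature.Analysis.FluidPDE

namespace LeiZhang2011

/-- **Hölder `(3/2, 3)` against a constant.** On a finite measure space, for an a.e.-measurable
`f ≥ 0` bounded a.e., `∫ f ≤ μ(univ)^{1/3} · (∫ f^{3/2})^{2/3}`. [folklore] -/
theorem integral_le_measureReal_rpow_mul {α : Type*} [MeasurableSpace α] {μ : Measure α}
    [IsFiniteMeasure μ] {f : α → ℝ} (hfm : AEStronglyMeasurable f μ) (hf0 : 0 ≤ᵐ[μ] f)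
    {C : ℝ} (hfC : ∀ᵐ x ∂μ, ‖f x‖ ≤ C) :
    ∫ x, f x ∂μ ≤ μ.real univ ^ (1 / (3 : ℝ)) * (∫ x, f x ^ ((3 : ℝ) / 2) ∂μ) ^ (2 / (3 : ℝ)) := by
  have hpq : Real.HolderConjugate (3 / 2) 3 := ⟨by norm_num, by norm_num, by norm_num⟩
  have hf : MemLp f (ENNReal.ofReal (3 / 2)) μ :=
    (memLp_top_of_bound hfm C hfC).mono_exponent le_top
  have hg : MemLp (fun _ : α => (1 : ℝ)) (ENNReal.ofReal 3) μ := memLp_const 1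
  have h := integral_mul_le_Lp_mul_Lq_of_nonneg hpq hf0 (ae_of_all _ fun _ => zero_le_one) hf hg
  simp only [mul_one, Real.one_rpow, MeasureTheory.integral_const, smul_eq_mul] at h
  calc ∫ x, f x ∂μ ≤ (∫ x, f x ^ (3 / 2 : ℝ) ∂μ) ^ (1 / (3 / 2 : ℝ)) * μ.real univ ^ (1 / (3 : ℝ)) := h
    _ = μ.real univ ^ (1 / (3 : ℝ)) * (∫ x, f x ^ ((3 : ℝ) / 2) ∂μ) ^ (2 / (3 : ℝ)) := by
        rw [mul_comm]; norm_num

/-- **Hölder `(3/2, 3)` on a compact set of `ℝ³`**: for `f ≥ 0` continuous and `K` compact,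
`∫_K f ≤ |K|^{1/3} (∫_K f^{3/2})^{2/3}` (Lei–Zhang 2011, p. 7, the lower-order term of (2.4)).
[cite: LeiZhang2011, §2 (arXiv p. 7), Hölder step] -/
theorem setIntegral_le_volumeReal_rpow_mul {f : EuclideanSpace ℝ (Fin 3) → ℝ} (hf : Continuous f)
    (hf0 : ∀ x, 0 ≤ f x) {K : Set (EuclideanSpace ℝ (Fin 3))} (hK : IsCompact K) :
    ∫ x in K, f x ≤ (volume.real K) ^ (1 / (3 : ℝ)) * (∫ x in K, f x ^ ((3 : ℝ) / 2)) ^ (2 / (3 : ℝ)) := by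
  haveI : IsFiniteMeasure ((volume : Measure (EuclideanSpace ℝ (Fin 3))).restrict K) :=
    ⟨by rw [Measure.restrict_apply_univ]; exact hK.measure_lt_top⟩
  obtain ⟨C, hC⟩ : ∃ C, ∀ x ∈ K, ‖f x‖ ≤ C := hK.exists_bound_of_continuousOn hf.continuousOn
  have h := integral_le_measureReal_rpow_mul (μ := (volume : Measure (EuclideanSpace ℝ (Fin 3))).restrict K)
    hf.aestronglyMeasurable (ae_of_all _ hf0) (C := C)
    ((ae_restrict_iff' hK.measurableSet).2 (ae_of_all _ hC))
  rwa [measureReal_restrict_apply_univ] at h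

/-- **Hölder `(3/2, 3)` in time**: for `y ≥ 0` continuous on `[t₁, 0]`,
`∫_{t₁}^0 y^{2/3} ≤ (−t₁)^{1/3} (∫_{t₁}^0 y)^{2/3}` (Lei–Zhang 2011, p. 7: the `L²ₜ`–`L³ₜ` Hölder
step turning `∫ ‖f(s)‖²_{L³} ds` into `‖f‖²_{L³ₜL³ₓ} R^{2/3}`). [cite: LeiZhang2011, §2 (arXiv p. 7), Hölder step] -/
theorem intervalIntegral_rpow_two_thirds_le {t₁ : ℝ} (ht : t₁ ≤ 0) {y : ℝ → ℝ}
    (hyc : ContinuousOn y (Icc t₁ 0)) (hy0 : ∀ s ∈ Icc t₁ 0, 0 ≤ y s) :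
    ∫ s in t₁..0, y s ^ (2 / (3 : ℝ)) ≤ (-t₁) ^ (1 / (3 : ℝ)) * (∫ s in t₁..0, y s) ^ (2 / (3 : ℝ)) := by
  set μ : Measure ℝ := volume.restrict (Ioc t₁ 0) with hμ
  haveI : IsFiniteMeasure μ := ⟨by
    rw [hμ, Measure.restrict_apply_univ, Real.volume_Ioc]; exact ENNReal.ofReal_lt_top⟩
  have hμu : μ.real univ = -t₁ := by
    rw [hμ, measureReal_restrict_apply_univ, Real.volume_real_Ioc_of_le ht]; ring
  -- the function `y^{2/3}` on `[t₁, 0]`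
  have hfc : ContinuousOn (fun s => y s ^ (2 / (3 : ℝ))) (Icc t₁ 0) :=
    hyc.rpow_const fun s _ => Or.inr (by norm_num)
  obtain ⟨C, hC⟩ : ∃ C, ∀ s ∈ Icc t₁ 0, ‖y s ^ (2 / (3 : ℝ))‖ ≤ C :=
    isCompact_Icc.exists_bound_of_continuousOn hfc
  have hfm : AEStronglyMeasurable (fun s => y s ^ (2 / (3 : ℝ))) μ :=
    (hfc.aestronglyMeasurable measurableSet_Icc).mono_measure (Measure.restrict_mono Ioc_subset_Icc_self le_rfl)
  have hf0 : 0 ≤ᵐ[μ] fun s => y s ^ (2 / (3 : ℝ)) := by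
    refine (ae_restrict_iff' measurableSet_Ioc).2 (ae_of_all _ fun s hs => ?_)
    exact Real.rpow_nonneg (hy0 s ⟨hs.1.le, hs.2⟩) _
  have hfC : ∀ᵐ s ∂μ, ‖y s ^ (2 / (3 : ℝ))‖ ≤ C :=
    (ae_restrict_iff' measurableSet_Ioc).2 (ae_of_all _ fun s hs => hC s ⟨hs.1.le, hs.2⟩)
  have h := integral_le_measureReal_rpow_mul hfm hf0 hfC
  -- `(y^{2/3})^{3/2} = y` on `[t₁, 0]`
  have hpow : ∫ s, (y s ^ (2 / (3 : ℝ))) ^ ((3 : ℝ) / 2) ∂μ = ∫ s, y s ∂μ := by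
    refine integral_congr_ae ((ae_restrict_iff' measurableSet_Ioc).2 (ae_of_all _ fun s hs => ?_))
    show (y s ^ (2 / (3 : ℝ))) ^ ((3 : ℝ) / 2) = y s
    rw [← Real.rpow_mul (hy0 s ⟨hs.1.le, hs.2⟩)]
    norm_num
  rw [hpow, hμu] at h
  rw [integral_of_le ht, integral_of_le ht]
  exact h

end LeiZhang2011

end Literature.Analysis.FluidPDE

namespace Literature.Analysis.FluidPDE

namespace LeiZhang2011

/-- **The cut-off terms of the energy inequality are controlled by `‖H(F)‖_{L^{3/2}ₜₓ}`**
(Lei–Zhang 2011, p. 7, "(2.3) implies (2.4) by Hölder"): for `H(F)` jointly continuous and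
nonnegative, a compact `K ⊂ ℝ³`, `t₁ ≤ 0` and `c₁, c₂ ≥ 0`,
`∫_{t₁}^0 (c₁ ∫_K H(F) + c₂ (∫_K H(F)^{3/2})^{2/3}) ds`
`  ≤ (c₁ |K|^{1/3} + c₂) (−t₁)^{1/3} (∫_{t₁}^0 ∫_K H(F)^{3/2})^{2/3}`.
In the application `c₁ = (κ/ε) D² + D'` (viscous cut-off and time cut-off terms) and
`c₂ = (κ/ε) D² C_J ‖B‖²_BMO |B_r|^{1/3}` (the John–Nirenberg bound of the stream-function term). [cite: LeiZhang2011, §2 (arXiv p. 7), "(2.3) implies (2.4)"] -/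
theorem intervalIntegral_cutoff_terms_le {F : ℝ → EuclideanSpace ℝ (Fin 3) → ℝ} {H : ℝ → ℝ}
    (hHF : Continuous fun p : ℝ × EuclideanSpace ℝ (Fin 3) => H (F p.1 p.2))
    (hH0 : ∀ s x, 0 ≤ H (F s x)) {K : Set (EuclideanSpace ℝ (Fin 3))} (hK : IsCompact K)
    {t₁ : ℝ} (ht : t₁ ≤ 0) {c₁ c₂ : ℝ} (hc₁ : 0 ≤ c₁) (hc₂ : 0 ≤ c₂) :
    ∫ s in t₁..0, (c₁ * (∫ x in K, H (F s x)) +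
        c₂ * (∫ x in K, H (F s x) ^ ((3 : ℝ) / 2)) ^ (2 / (3 : ℝ))) ≤
      (c₁ * (volume.real K) ^ (1 / (3 : ℝ)) + c₂) * (-t₁) ^ (1 / (3 : ℝ)) *
        (∫ s in t₁..0, ∫ x in K, H (F s x) ^ ((3 : ℝ) / 2)) ^ (2 / (3 : ℝ)) := by
  -- the slice functionals and their continuity in time
  set A : ℝ → ℝ := fun s => ∫ x in K, H (F s x) with hA
  set Y : ℝ → ℝ := fun s => ∫ x in K, H (F s x) ^ ((3 : ℝ) / 2) with hY
  have hHF32 : Continuous fun p : ℝ × EuclideanSpace ℝ (Fin 3) => H (F p.1 p.2) ^ ((3 : ℝ) / 2) :=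
    hHF.rpow_const fun p => Or.inr (by norm_num)
  have hAc : Continuous A :=
    continuous_parametric_integral_of_continuous (f := fun s x => H (F s x)) hHF hK
  have hYc : Continuous Y :=
    continuous_parametric_integral_of_continuous (f := fun s x => H (F s x) ^ ((3 : ℝ) / 2)) hHF32 hK
  have hY0 : ∀ s, 0 ≤ Y s := fun s =>
    integral_nonneg fun x => Real.rpow_nonneg (hH0 s x) _
  have hslicec : ∀ s, Continuous fun x => H (F s x) := fun s =>
    hHF.comp (continuous_const.prodMk continuous_id)
  -- slice Hölder: `A ≤ |K|^{1/3} Y^{2/3}`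
  have hAle : ∀ s, A s ≤ (volume.real K) ^ (1 / (3 : ℝ)) * Y s ^ (2 / (3 : ℝ)) := fun s =>
    setIntegral_le_volumeReal_rpow_mul (hslicec s) (hH0 s) hK
  -- time Hölder: `∫ Y^{2/3} ≤ (−t₁)^{1/3} X^{2/3}`
  have hYle := intervalIntegral_rpow_two_thirds_le ht hYc.continuousOn fun s _ => hY0 s
  -- integrability
  have hAi : IntervalIntegrable A volume t₁ 0 := hAc.intervalIntegrable _ _
  have hY23c : Continuous fun s => Y s ^ (2 / (3 : ℝ)) := hYc.rpow_const fun s => Or.inr (by norm_num)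
  have hY23i : IntervalIntegrable (fun s => Y s ^ (2 / (3 : ℝ))) volume t₁ 0 :=
    hY23c.intervalIntegrable _ _
  -- split the integral
  have hsplit : ∫ s in t₁..0, (c₁ * A s + c₂ * Y s ^ (2 / (3 : ℝ))) =
      c₁ * (∫ s in t₁..0, A s) + c₂ * ∫ s in t₁..0, Y s ^ (2 / (3 : ℝ)) := by
    rw [intervalIntegral.integral_add (hAi.const_mul c₁) (hY23i.const_mul c₂),
      intervalIntegral.integral_const_mul, intervalIntegral.integral_const_mul]
  have hA_int : ∫ s in t₁..0, A s ≤ (volume.real K) ^ (1 / (3 : ℝ)) * ∫ s in t₁..0, Y s ^ (2 / (3 : ℝ)) := by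
    rw [← intervalIntegral.integral_const_mul]
    exact intervalIntegral.integral_mono_on ht hAi (hY23i.const_mul _) fun s _ => hAle s
  have hI0 : 0 ≤ ∫ s in t₁..0, Y s ^ (2 / (3 : ℝ)) :=
    intervalIntegral.integral_nonneg ht fun s _ => Real.rpow_nonneg (hY0 s) _
  have hK0 : 0 ≤ (volume.real K) ^ (1 / (3 : ℝ)) := Real.rpow_nonneg measureReal_nonneg _
  show ∫ s in t₁..0, (c₁ * A s + c₂ * Y s ^ (2 / (3 : ℝ))) ≤
    (c₁ * (volume.real K) ^ (1 / (3 : ℝ)) + c₂) * (-t₁) ^ (1 / (3 : ℝ)) * (∫ s in t₁..0, Y s) ^ (2 / (3 : ℝ))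
  rw [hsplit]
  have hX0 : 0 ≤ (-t₁) ^ (1 / (3 : ℝ)) * (∫ s in t₁..0, Y s) ^ (2 / (3 : ℝ)) :=
    mul_nonneg (Real.rpow_nonneg (by linarith) _)
      (Real.rpow_nonneg (intervalIntegral.integral_nonneg ht fun s _ => hY0 s) _)
  calc c₁ * (∫ s in t₁..0, A s) + c₂ * ∫ s in t₁..0, Y s ^ (2 / (3 : ℝ))
      ≤ c₁ * ((volume.real K) ^ (1 / (3 : ℝ)) * ∫ s in t₁..0, Y s ^ (2 / (3 : ℝ))) +
          c₂ * ∫ s in t₁..0, Y s ^ (2 / (3 : ℝ)) := by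
        gcongr
    _ = (c₁ * (volume.real K) ^ (1 / (3 : ℝ)) + c₂) * ∫ s in t₁..0, Y s ^ (2 / (3 : ℝ)) := by ring
    _ ≤ (c₁ * (volume.real K) ^ (1 / (3 : ℝ)) + c₂) *
          ((-t₁) ^ (1 / (3 : ℝ)) * (∫ s in t₁..0, Y s) ^ (2 / (3 : ℝ))) :=
        mul_le_mul_of_nonneg_left hYle (by positivity)
    _ = (c₁ * (volume.real K) ^ (1 / (3 : ℝ)) + c₂) * (-t₁) ^ (1 / (3 : ℝ)) *
          (∫ s in t₁..0, Y s) ^ (2 / (3 : ℝ)) := by ring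

end LeiZhang2011

end Literature.Analysis.FluidPDE
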